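import Summits.QuantumFields.BalabanUV.T4Continuum.Support.NE7K1LinTorusFineWavesFibre

/-!
# NE7K1LinTorusResolventFibre — row NE7 (node U5), candidate route HOM, path H1L, cell K1-lin(s): NEEDS-ESTIMATE #E1, R-E1 TRANCHE E
# (operator-level torus docking), STEP 1 — THE SOFT RESOLVENT ON ONE ALIAS FIBRE: for a fine operator `M` whose fibre waves `e_{q_k}`
# (`q_k = p + P∘k`) are eigenvectors with eigenvalues `m̂_k ≠ 0`, the explicit field
# `Φ_p = Σ_k conj(w_k)·e_{q_k} ∕ (m̂_k·(1 + a·Σ_l U_L(l;θ)∕m̂_l))` solves `(M + a·L^{−(d+1)}·SᵀS)Φ_p = χ_p ∘ blk` — B4 (2.44)–(2.47)'s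
# Sherman–Morrison step on the torus, as a VERIFICATION (no inverse, no uniqueness), the soft (`a < ∞`) sibling of file 58's pairing

Lineage `b2b-balaban-t4-ne7-p2` (CRUX PROVER NE7 #2), generation 76; file 72.  Files 62–71 (this gen) put B4 (2.35)–(2.36) for the
regrouped (2.48)∕(2.49) MULTIPLIERS of `(σ_s^{(n)} + aQ*Q)⁻¹Q*` in kernel along the whole two-cutoff line; what R-E1 still lacks is the
OPERATOR-LEVEL identity on the fine torus («the multiplier `GS` IS the kernel of `(T^𝕋(s) + aQ_n^*Q_n)⁻¹Q_n^*`» — b04's `B4Torus248Decay`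
(ii) leaves the same untyped for `G_jQ_j^*`).  Its core is B4 p. 584–585 (2.44)–(2.47): on each alias fibre `{q_k = p + P∘k}` the
operator `−Δ^ξ + aQ*Q` is «diagonal + rank one», and (2.47) is its Sherman–Morrison inverse applied to `Q*χ_p`.  THIS FILE types that
step for ANY fine operator with the fibre waves as eigenvectors ([folklore] finite-dimensional algebra over files 56–57's block sums
(3a), modulus (3b) and completeness (3c) BY NAME):

* §1 `aliasSum m̂ p = Σ_k U_L(k; θ(p))∕m̂_k`, the coefficients `resCoef`, and THE RESOLVENT FIELD
  **`resField L Pf Pc m̂ a p x = Σ_k conj(w_k(p))·χ_{q_k}(x) ∕ (m̂_k·(1 + a·aliasSum))`**.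
* §2 the two actions: `M·Φ_p = (Σ_k conj(w_k)e_{q_k}) ∕ E = (χ_p∘blk) ∕ E` (`sum_M_resField`: eigen-relation + completeness (3c)) and
  the block sums `Σ_{x′ ∈ block(x)} Φ_p(x′) = L^{d+1}·χ_p(blk x)·aliasSum ∕ E` (`blockSum_resField`: (3a) + (3b)).
* §3 **`soft_resolvent`**: `Σ_{x′} M(x,x′)Φ_p(x′) + a·L^{−(d+1)}·Σ_{x′ ∈ block(x)} Φ_p(x′) = χ_p(blk x)` for every fine point `x` of the
  block-union region — i.e. `(M + a·Q*Q)Φ_p = Q*χ_p` with `Q*Q = L^{−(d+1)}·1[same block]`, `Q* = ` block indicator; hypotheses: fine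
  period `Pf = L·Pc`, `|p_μ| < Pc_μ`, `m̂_k ≠ 0`, `1 + a·aliasSum ≠ 0` (no symmetry of `M` is needed for this direction).

NEXT (tranche E steps 2–3, successor): instantiate `M := torLineRep hn M s` on the fine doubled torus with blocking factor `L := n`
(eigen-relation `torLine_zero_planeWave` + `lineSymb_eq_torSymb`∕periodicity, the `a`-split `torLine(a) = torLine(0) + a·n^{−(d+1)}SᵀS`,
invertibility `isUnit_det_torLine` ⇒ `(torLine(a,s))⁻¹Sᵀχ_p = Φ_p` with `1∕(m̂_k E) = RS_k∕ES`), then Fourier-invert over `p`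
(`sum_chiT_dual`) to the kernel `torusKernelS n (lineSymb L n s) a τ (2M) (x⁰ − y)` of file 68.

HONEST FRAMING: [folklore] linear algebra; a verification identity between explicitly given finite sums; nothing of Bałaban's asserted;
no `sorry`.  Census only; NE7 NOT PRINTED ∕ NOT PROVED; spine 0∕9; FIXED FINITE T⁴, rung (B)+1; NOT infinite volume, NOT mass gap, NOT
Clay.  HONEST DEPENDENCY: continuum YM on T⁴ ⇐ BetaPertH ∧ nine spine estimates (0/9 proved); BetaPertH ⇐ (D1) ∧ (D4) ∧ CAP+tail;
G-an2-4 gates asym, D1 and NE2/3/4.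
-/

noncomputable section

open Finset Matrix Complex

namespace Summit.QuantumFields.BalabanUV.T4Continuum.NE7K1LinTorusResolventFibre

open Literature.MathematicalPhysics.QuantumFieldTheory.Balaban1983to89
open Literature.MathematicalPhysics.QuantumFieldTheory.Balaban1983to89.B4Reflection242
open Literature.MathematicalPhysics.QuantumFieldTheory.Balaban1983to89.B4Lower18
open Literature.MathematicalPhysics.QuantumFieldTheory.Balaban1983to89.B4Green244 (finePt)
open Literature.MathematicalPhysics.QuantumFieldTheory.Balaban1983to89.B4Strip (Ur)
open NE7K1LinTorusLineSymbol NE7K1LinTorusFineWaves NE7K1LinTorusFineWavesFibre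

variable {d : ℕ}

section Fibre

variable {L : ℕ} [NeZero L] {Pf Pc : Fin (d + 1) → ℕ} {T : Finset (Fin (d + 1) → ℤ)}

/-! ### §1 The alias sum and the resolvent field of one coarse momentum -/

/-- THE ALIAS SUM `A(p) = Σ_k U_L(k; θ(p)) ∕ m̂_k` of (2.46)–(2.47) over a general eigenvalue family `m̂`. [folklore] -/
def aliasSum (L : ℕ) [NeZero L] (Pc : Fin (d + 1) → ℕ) (mhat : (Fin (d + 1) → Fin L) → ℂ) (p : Fin (d + 1) → ℤ) : ℂ :=
  ∑ k : Fin (d + 1) → Fin L, ((Ur L k (thetaOf Pc p) : ℝ) : ℂ) / mhat k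

/-- the coefficient of the fibre wave `e_{q_k}` in the resolvent field: `conj(w_k) ∕ (m̂_k·(1 + a·A))`. [folklore] -/
def resCoef (L : ℕ) [NeZero L] (Pc : Fin (d + 1) → ℕ) (mhat : (Fin (d + 1) → Fin L) → ℂ) (a : ℝ) (p : Fin (d + 1) → ℤ)
    (k : Fin (d + 1) → Fin L) : ℂ :=
  starRingEnd ℂ (wMean L Pc p k) / (mhat k * (1 + (a : ℂ) * aliasSum L Pc mhat p))

/-- **THE RESOLVENT FIELD OF THE COARSE MOMENTUM `p`**: `Φ_p(x) = Σ_k conj(w_k(p))·χ_{q_k}(x) ∕ (m̂_k·(1 + a·A(p)))` — B4 (2.47)'s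
fine field (the `l`-sum with the Sherman–Morrison denominator) over a general eigenvalue family. [folklore] -/
def resField (L : ℕ) [NeZero L] (Pf Pc : Fin (d + 1) → ℕ) (mhat : (Fin (d + 1) → Fin L) → ℂ) (a : ℝ) (p : Fin (d + 1) → ℤ)
    (x : Fin (d + 1) → ℤ) : ℂ :=
  ∑ k : Fin (d + 1) → Fin L, resCoef L Pc mhat a p k * chiT Pf (fibMom Pc p k) x

/-! ### §2 The two actions on the resolvent field -/

/-- the fine operator acts fibrewise: `Σ_{x′} M(x,x′)Φ_p(x′) = Σ_k c_k·m̂_k·χ_{q_k}(x)`. [folklore] -/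
theorem sum_M_resField_eq (Mf : Matrix ↥T ↥T ℝ) (mhat : (Fin (d + 1) → Fin L) → ℂ) (a : ℝ) (p : Fin (d + 1) → ℤ)
    (heig : ∀ (k : Fin (d + 1) → Fin L) (x : ↥T),
      ∑ x' : ↥T, (Mf x x' : ℂ) * chiT Pf (fibMom Pc p k) x'.1 = mhat k * chiT Pf (fibMom Pc p k) x.1)
    (x : ↥T) :
    ∑ x' : ↥T, (Mf x x' : ℂ) * resField L Pf Pc mhat a p x'.1 =
      ∑ k : Fin (d + 1) → Fin L, resCoef L Pc mhat a p k * (mhat k * chiT Pf (fibMom Pc p k) x.1) := by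
  unfold resField
  simp_rw [Finset.mul_sum]
  rw [Finset.sum_comm]
  refine Finset.sum_congr rfl (fun k _ => ?_)
  rw [← heig k x, Finset.mul_sum]
  refine Finset.sum_congr rfl (fun x' _ => ?_)
  ring

/-- completeness on the fibre: `Σ_k c_k·m̂_k·χ_{q_k}(x) = χ_p(blk x) ∕ (1 + aA)` at every point of a block-union region
(`c_k·m̂_k = conj(w_k)∕(1 + aA)` and (3c)). [folklore] -/
theorem sum_resCoef_mhat_wave (hPf : Pf = fun i => L * Pc i) (hPc : ∀ i, 1 ≤ Pc i) (hTL : IsBlockUnion L T)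
    (mhat : (Fin (d + 1) → Fin L) → ℂ) (hmhat : ∀ k, mhat k ≠ 0) (a : ℝ) (p : Fin (d + 1) → ℤ)
    (hE : 1 + (a : ℂ) * aliasSum L Pc mhat p ≠ 0) (x : ↥T) :
    ∑ k : Fin (d + 1) → Fin L, resCoef L Pc mhat a p k * (mhat k * chiT Pf (fibMom Pc p k) x.1) =
      chiT Pc p (rblk L T x).1 / (1 + (a : ℂ) * aliasSum L Pc mhat p) := by
  obtain ⟨j, hj⟩ := rchart_surj (NeZero.one_le) hTL x
  have hc : ∀ k : Fin (d + 1) → Fin L, resCoef L Pc mhat a p k * (mhat k * chiT Pf (fibMom Pc p k) x.1) =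
      starRingEnd ℂ (wMean L Pc p k) * chiT Pf (fibMom Pc p k) x.1 / (1 + (a : ℂ) * aliasSum L Pc mhat p) := by
    intro k
    unfold resCoef
    field_simp [hmhat k, hE]
  simp_rw [hc]
  rw [← Finset.sum_div]
  congr 1
  rw [← hj, rblk_rchart]
  exact sum_conj_wMean_mul_fibWave_rchart hPf hPc hTL p (rblk L T x) j

/-- **THE FINE OPERATOR ON THE RESOLVENT FIELD**: `Σ_{x′} M(x,x′)Φ_p(x′) = χ_p(blk x) ∕ (1 + a·A(p))`. [folklore] -/
theorem sum_M_resField (hPf : Pf = fun i => L * Pc i) (hPc : ∀ i, 1 ≤ Pc i) (hTL : IsBlockUnion L T)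
    (Mf : Matrix ↥T ↥T ℝ) (mhat : (Fin (d + 1) → Fin L) → ℂ) (hmhat : ∀ k, mhat k ≠ 0)
    {p : Fin (d + 1) → ℤ}
    (heig : ∀ (k : Fin (d + 1) → Fin L) (x : ↥T),
      ∑ x' : ↥T, (Mf x x' : ℂ) * chiT Pf (fibMom Pc p k) x'.1 = mhat k * chiT Pf (fibMom Pc p k) x.1)
    (a : ℝ) (hE : 1 + (a : ℂ) * aliasSum L Pc mhat p ≠ 0) (x : ↥T) :
    ∑ x' : ↥T, (Mf x x' : ℂ) * resField L Pf Pc mhat a p x'.1 =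
      chiT Pc p (rblk L T x).1 / (1 + (a : ℂ) * aliasSum L Pc mhat p) := by
  rw [sum_M_resField_eq Mf mhat a p heig x]
  exact sum_resCoef_mhat_wave hPf hPc hTL mhat hmhat a p hE x

/-- **THE BLOCK SUMS OF THE RESOLVENT FIELD**: `Σ_{x′ ∈ block β} Φ_p(x′) = L^{d+1}·χ_p(β)·A(p) ∕ (1 + a·A(p))` ((3a) block sums of the
fibre waves and (3b) `conj(w_k)·w_k = U_L(k;θ)`). [folklore] -/
theorem blockSum_resField (hPf : Pf = fun i => L * Pc i) (hPc : ∀ i, 1 ≤ Pc i) (hTL : IsBlockUnion L T)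
    (mhat : (Fin (d + 1) → Fin L) → ℂ) (hmhat : ∀ k, mhat k ≠ 0) {p : Fin (d + 1) → ℤ} (hp : ∀ μ, |p μ| < Pc μ)
    (a : ℝ) (hE : 1 + (a : ℂ) * aliasSum L Pc mhat p ≠ 0) (β : ↥(T.image (blk L))) :
    ∑ x' ∈ Finset.univ.filter (fun x' : ↥T => rblk L T x' = β), resField L Pf Pc mhat a p x'.1 =
      (L : ℂ) ^ (d + 1) * chiT Pc p β.1 * (aliasSum L Pc mhat p / (1 + (a : ℂ) * aliasSum L Pc mhat p)) := by
  unfold resField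
  rw [Finset.sum_comm]
  simp_rw [← Finset.mul_sum, sum_block_fibWave hPf hPc hTL β p]
  -- each summand: `c_k · L^{d+1} w_k χ_p(β) = L^{d+1} χ_p(β) · U_k∕(m̂_k (1 + aA))`
  have hk : ∀ k : Fin (d + 1) → Fin L, resCoef L Pc mhat a p k * ((L : ℂ) ^ (d + 1) * wMean L Pc p k * chiT Pc p β.1) =
      (L : ℂ) ^ (d + 1) * chiT Pc p β.1 *
        ((((Ur L k (thetaOf Pc p) : ℝ) : ℂ) / mhat k) / (1 + (a : ℂ) * aliasSum L Pc mhat p)) := by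
    intro k
    unfold resCoef
    rw [← wMean_mul_conj hPc hp k]
    field_simp [hmhat k, hE]
  simp_rw [hk]
  rw [← Finset.mul_sum, ← Finset.sum_div]
  rfl

/-! ### §3 The soft resolvent identity -/

/-- **THE SOFT RESOLVENT ON ONE ALIAS FIBRE (B4 (2.44)–(2.47) on the torus, Sherman–Morrison as a verification)**: for a fine operator `M`
on a block-union region `T` (fine period `Pf = L·Pc`) whose fibre waves `χ_{q_k}`, `q_k = p + Pc∘k`, are eigenvectors with eigenvalues
`m̂_k ≠ 0`, a coarse momentum `|p_μ| < Pc_μ`, and `a` with `1 + a·A(p) ≠ 0`: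
`Σ_{x′} M(x,x′)Φ_p(x′) + a·L^{−(d+1)}·Σ_{x′ ∈ block(x)} Φ_p(x′) = χ_p(blk x)` at every `x ∈ T` — `(M + a·Q*Q)Φ_p = Q*χ_p` with
`Q*Q = L^{−(d+1)}·1[same block]`.  No symmetry, reality or positivity of `M` is used. [folklore] -/
theorem soft_resolvent (hPf : Pf = fun i => L * Pc i) (hPc : ∀ i, 1 ≤ Pc i) (hTL : IsBlockUnion L T)
    (Mf : Matrix ↥T ↥T ℝ) (mhat : (Fin (d + 1) → Fin L) → ℂ) (hmhat : ∀ k, mhat k ≠ 0)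
    {p : Fin (d + 1) → ℤ} (hp : ∀ μ, |p μ| < Pc μ)
    (heig : ∀ (k : Fin (d + 1) → Fin L) (x : ↥T),
      ∑ x' : ↥T, (Mf x x' : ℂ) * chiT Pf (fibMom Pc p k) x'.1 = mhat k * chiT Pf (fibMom Pc p k) x.1)
    (a : ℝ) (hE : 1 + (a : ℂ) * aliasSum L Pc mhat p ≠ 0) (x : ↥T) :
    ∑ x' : ↥T, (Mf x x' : ℂ) * resField L Pf Pc mhat a p x'.1 +
        (a : ℂ) * ((L : ℂ) ^ (d + 1))⁻¹ *
          ∑ x' ∈ Finset.univ.filter (fun x' : ↥T => rblk L T x' = rblk L T x), resField L Pf Pc mhat a p x'.1 =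
      chiT Pc p (rblk L T x).1 := by
  have hℓ0 : ((L : ℂ) ^ (d + 1)) ≠ 0 := pow_ne_zero _ (by exact_mod_cast NeZero.ne L)
  rw [sum_M_resField hPf hPc hTL Mf mhat hmhat heig a hE x, blockSum_resField hPf hPc hTL mhat hmhat hp a hE (rblk L T x)]
  field_simp

/-- the same with the block-indicator written as a matrix entry sum: `Σ_{x′} (M(x,x′) + a·L^{−(d+1)}·[blk x′ = blk x])·Φ_p(x′) = χ_p(blk x)`.
[folklore] -/
theorem soft_resolvent' (hPf : Pf = fun i => L * Pc i) (hPc : ∀ i, 1 ≤ Pc i) (hTL : IsBlockUnion L T)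
    (Mf : Matrix ↥T ↥T ℝ) (mhat : (Fin (d + 1) → Fin L) → ℂ) (hmhat : ∀ k, mhat k ≠ 0)
    {p : Fin (d + 1) → ℤ} (hp : ∀ μ, |p μ| < Pc μ)
    (heig : ∀ (k : Fin (d + 1) → Fin L) (x : ↥T),
      ∑ x' : ↥T, (Mf x x' : ℂ) * chiT Pf (fibMom Pc p k) x'.1 = mhat k * chiT Pf (fibMom Pc p k) x.1)
    (a : ℝ) (hE : 1 + (a : ℂ) * aliasSum L Pc mhat p ≠ 0) (x : ↥T) :
    ∑ x' : ↥T, ((Mf x x' : ℂ) + (if rblk L T x' = rblk L T x then (a : ℂ) * ((L : ℂ) ^ (d + 1))⁻¹ else 0)) *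
        resField L Pf Pc mhat a p x'.1 = chiT Pc p (rblk L T x).1 := by
  rw [← soft_resolvent hPf hPc hTL Mf mhat hmhat hp heig a hE x]
  simp_rw [add_mul, Finset.sum_add_distrib, ite_mul, zero_mul, Finset.sum_ite, Finset.sum_const_zero, add_zero,
    ← Finset.mul_sum]

/-! ### §4 The REGROUPED resolvent field (the zero mode included: `m̂_0 = σ(p′)` may vanish) -/

/-- the regrouped ratio on the fibre: `RSf_k = 1` at the base residue `k = 0`, `= m̂_0∕m̂_k` otherwise (b04's `R_k = σ(p′)∕σ(p′+2πk)`). [folklore] -/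
def RSf (L : ℕ) [NeZero L] (mhat : (Fin (d + 1) → Fin L) → ℂ) (k : Fin (d + 1) → Fin L) : ℂ :=
  if k = fun _ => 0 then 1 else mhat (fun _ => 0) / mhat k

/-- the regrouped denominator on the fibre: `ESf = m̂_0 + a·U_0 + a·Σ_{k≠0} U_k·m̂_0∕m̂_k` (b04's `E`, file 62's `ES`, at one coarse momentum). [folklore] -/
def ESf (L : ℕ) [NeZero L] (Pc : Fin (d + 1) → ℕ) (mhat : (Fin (d + 1) → Fin L) → ℂ) (a : ℝ) (p : Fin (d + 1) → ℤ) : ℂ :=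
  mhat (fun _ => 0) + (a : ℂ) * ((Ur L (fun _ => 0) (thetaOf Pc p) : ℝ) : ℂ) +
    (a : ℂ) * ∑ k ∈ Finset.univ.erase (fun _ => (0 : Fin L)), ((Ur L k (thetaOf Pc p) : ℝ) : ℂ) * (mhat (fun _ => 0) / mhat k)

/-- `m̂_k·RSf_k = m̂_0` for every `k` (`m̂_k ≠ 0` off the base residue). [folklore] -/
theorem mhat_mul_RSf (mhat : (Fin (d + 1) → Fin L) → ℂ) (hmhat : ∀ k, k ≠ (fun _ => 0) → mhat k ≠ 0) (k : Fin (d + 1) → Fin L) :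
    mhat k * RSf L mhat k = mhat (fun _ => 0) := by
  unfold RSf
  split_ifs with hk
  · rw [hk, mul_one]
  · rw [mul_div_cancel₀ _ (hmhat k hk)]

/-- the regrouped denominator is `m̂_0 + a·Σ_k U_k·RSf_k`. [folklore] -/
theorem ESf_eq (mhat : (Fin (d + 1) → Fin L) → ℂ) (a : ℝ) (p : Fin (d + 1) → ℤ) :
    ESf L Pc mhat a p = mhat (fun _ => 0) + (a : ℂ) * ∑ k : Fin (d + 1) → Fin L, ((Ur L k (thetaOf Pc p) : ℝ) : ℂ) * RSf L mhat k := by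
  unfold ESf
  rw [← Finset.add_sum_erase Finset.univ _ (Finset.mem_univ (fun _ => (0 : Fin L)))]
  have e0 : RSf L mhat (fun _ => 0) = 1 := by unfold RSf; rw [if_pos rfl]
  have e1 : ∀ k ∈ Finset.univ.erase (fun _ => (0 : Fin L)), ((Ur L k (thetaOf Pc p) : ℝ) : ℂ) * RSf L mhat k =
      ((Ur L k (thetaOf Pc p) : ℝ) : ℂ) * (mhat (fun _ => 0) / mhat k) := by
    intro k hk
    unfold RSf
    rw [if_neg (Finset.ne_of_mem_erase hk)]
  rw [e0, mul_one, Finset.sum_congr rfl e1]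
  ring

/-- THE REGROUPED RESOLVENT FIELD: `Φ^R_p(x) = Σ_k conj(w_k)·RSf_k·χ_{q_k}(x) ∕ ESf` — equal to `resField` where `m̂_0 ≠ 0`, and finite at the
zero mode (`m̂_0 = 0` ⇒ only the base residue survives, `Φ^R = conj(w_0)χ_{q_0}∕(aU_0)`). [folklore] -/
def resFieldR (L : ℕ) [NeZero L] (Pf Pc : Fin (d + 1) → ℕ) (mhat : (Fin (d + 1) → Fin L) → ℂ) (a : ℝ) (p : Fin (d + 1) → ℤ)
    (x : Fin (d + 1) → ℤ) : ℂ :=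
  ∑ k : Fin (d + 1) → Fin L, starRingEnd ℂ (wMean L Pc p k) * RSf L mhat k / ESf L Pc mhat a p * chiT Pf (fibMom Pc p k) x

/-- **THE SOFT RESOLVENT, REGROUPED FORM (zero mode included)**: with `m̂_k ≠ 0` for `k ≠ 0` and `ESf ≠ 0` only,
`Σ_{x′} M(x,x′)Φ^R_p(x′) + a·L^{−(d+1)}·Σ_{x′ ∈ block(x)} Φ^R_p(x′) = χ_p(blk x)` — b04's regrouping through `E` is exactly what keeps
(2.47) finite at `p′ = 0` when the symbol is massless. [folklore] -/
theorem soft_resolvent_regrouped (hPf : Pf = fun i => L * Pc i) (hPc : ∀ i, 1 ≤ Pc i) (hTL : IsBlockUnion L T)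
    (Mf : Matrix ↥T ↥T ℝ) (mhat : (Fin (d + 1) → Fin L) → ℂ) (hmhat : ∀ k, k ≠ (fun _ => 0) → mhat k ≠ 0)
    {p : Fin (d + 1) → ℤ} (hp : ∀ μ, |p μ| < Pc μ)
    (heig : ∀ (k : Fin (d + 1) → Fin L) (x : ↥T),
      ∑ x' : ↥T, (Mf x x' : ℂ) * chiT Pf (fibMom Pc p k) x'.1 = mhat k * chiT Pf (fibMom Pc p k) x.1)
    (a : ℝ) (hE : ESf L Pc mhat a p ≠ 0) (x : ↥T) :
    ∑ x' : ↥T, (Mf x x' : ℂ) * resFieldR L Pf Pc mhat a p x'.1 +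
        (a : ℂ) * ((L : ℂ) ^ (d + 1))⁻¹ *
          ∑ x' ∈ Finset.univ.filter (fun x' : ↥T => rblk L T x' = rblk L T x), resFieldR L Pf Pc mhat a p x'.1 =
      chiT Pc p (rblk L T x).1 := by
  have hℓ0 : ((L : ℂ) ^ (d + 1)) ≠ 0 := pow_ne_zero _ (by exact_mod_cast NeZero.ne L)
  obtain ⟨j, hj⟩ := rchart_surj (NeZero.one_le) hTL x
  set E := ESf L Pc mhat a p with hEdef
  -- the fine operator: `Σ M Φ^R = (m̂_0∕E)·χ_p(blk x)`
  have h1 : ∑ x' : ↥T, (Mf x x' : ℂ) * resFieldR L Pf Pc mhat a p x'.1 = mhat (fun _ => 0) / E * chiT Pc p (rblk L T x).1 := by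
    unfold resFieldR
    simp_rw [Finset.mul_sum]
    rw [Finset.sum_comm]
    have hk : ∀ k : Fin (d + 1) → Fin L, ∑ x' : ↥T, (Mf x x' : ℂ) *
        (starRingEnd ℂ (wMean L Pc p k) * RSf L mhat k / E * chiT Pf (fibMom Pc p k) x'.1) =
        mhat (fun _ => 0) / E * (starRingEnd ℂ (wMean L Pc p k) * chiT Pf (fibMom Pc p k) x.1) := by
      intro k
      have e : ∑ x' : ↥T, (Mf x x' : ℂ) * (starRingEnd ℂ (wMean L Pc p k) * RSf L mhat k / E * chiT Pf (fibMom Pc p k) x'.1) =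
          starRingEnd ℂ (wMean L Pc p k) * RSf L mhat k / E * ∑ x' : ↥T, (Mf x x' : ℂ) * chiT Pf (fibMom Pc p k) x'.1 := by
        rw [Finset.mul_sum]; exact Finset.sum_congr rfl (fun x' _ => by ring)
      rw [e, heig k x, ← mhat_mul_RSf mhat hmhat k]
      field_simp
    rw [Finset.sum_congr rfl (fun k _ => hk k), ← Finset.mul_sum, ← hj, rblk_rchart,
      sum_conj_wMean_mul_fibWave_rchart hPf hPc hTL p (rblk L T x) j]
  -- the block sums: `Σ_{block} Φ^R = L^{d+1}·χ_p(blk x)·(Σ_k U_k RSf_k)∕E`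
  have h2 : ∑ x' ∈ Finset.univ.filter (fun x' : ↥T => rblk L T x' = rblk L T x), resFieldR L Pf Pc mhat a p x'.1 =
      (L : ℂ) ^ (d + 1) * chiT Pc p (rblk L T x).1 *
        ((∑ k : Fin (d + 1) → Fin L, ((Ur L k (thetaOf Pc p) : ℝ) : ℂ) * RSf L mhat k) / E) := by
    unfold resFieldR
    rw [Finset.sum_comm]
    simp_rw [← Finset.mul_sum, sum_block_fibWave hPf hPc hTL (rblk L T x) p]
    have hk : ∀ k : Fin (d + 1) → Fin L,
        starRingEnd ℂ (wMean L Pc p k) * RSf L mhat k / E * ((L : ℂ) ^ (d + 1) * wMean L Pc p k * chiT Pc p (rblk L T x).1) =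
        (L : ℂ) ^ (d + 1) * chiT Pc p (rblk L T x).1 * ((((Ur L k (thetaOf Pc p) : ℝ) : ℂ) * RSf L mhat k) / E) := by
      intro k
      rw [← wMean_mul_conj hPc hp k]
      field_simp
    rw [Finset.sum_congr rfl (fun k _ => hk k), ← Finset.mul_sum, ← Finset.sum_div]
  rw [h1, h2]
  have hE' := ESf_eq (Pc := Pc) mhat a p
  rw [← hEdef] at hE'
  field_simp
  rw [hE']
  ring

end Fibre

end Summit.QuantumFields.BalabanUV.T4Continuum.NE7K1LinTorusResolventFibre

end
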